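import Summits.BirchSwinnertonDyer.BirchSwinnertonDyer.Theorems.ByReductionTypeAtTwoFineSelmerConjAAtTwoAdditivePotGoodCubicPencil
import HarnessLib

/-!
# Route `ByReductionTypeAtTwo` (rung K4), crux C1″ `FineSelmerConjAAtTwoAdditivePotGood` (item stmt-BirchSwinnertonDyer-22615):
# WINDOW MEMBERS OF THE CUBIC PENCIL, REGIME BY REGIME — for `X³ + aX + b` with `(v₂ a, v₂ b)` normalised, an explicit
# `t ∈ {∞, 0, 1, 2, 4, t₀}` whose pencil value `256 Q(t)³/((4a³ + 27b²) f(t)²)` has `v₂ ∈ {1,2,5,7,8,9,10,11}`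
# (a `--supports 22615` file; seat `bsd-2adic-k4-w1` GEN 3; sequel of `…CubicPencil`; 2-adic valuation arithmetic only)

HONEST FRAMING (cell `bsd-2adic`, D-0036/D-0054): types-the-object-of; closes nothing; nothing booked; BSD is not proved by any
of this. KERNEL-ONLY (no named fact): every statement is `padicValRat` arithmetic over `ℚ`.

WHY. `…CubicPencil` §5 reduced «C1″ ⟹ `μ₂(ℚ(α)^{cyc}) = 0` for the `S₃`-cubic field `ℚ(α)`, `α³ + aα + b = 0`» to the existence
of ONE pencil parameter `t ∈ ℚ ∪ {∞}` in the window. Writing `A = v₂ a`, `B = v₂ b`, `Δ = v₂(4a³ + 27b²)` and normalising by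
`α ↦ α/2^k` (`(A, B) ↦ (A − 2k, B − 3k)`, pencil values unchanged) to `A, B ≥ 0 ∧ (A ≤ 1 ∨ B ≤ 2)`, the table is:

| `(A, B)` | `Δ` | member | value |      | `(A, B)` | `Δ` | member | value |
|---|---|---|---|---|---|---|---|---|
| `(0,0)` | `0` | `∞` | `8` | | `(1,0)` | `0` | `∞` | `11` |
| `(0,1)` | `3` / `6` | `∞` | `5` / `2` | | `(1,1)` | `2` | `∞` | `9` |
| `(0,1)` | `4` / `5` | `t = 0` | `2` / `1` | | `(1,2)` | `4` | `∞` | `7` |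
| `(0,1)` | `≥ 7` | `t₀ + 2^m` | `2` / `5` (sequel) | | `(1, ≥3)` | `5` | `t = 2` | `5` |
| `(0,2)` | `2` | `t = 0` | `2` | | `(≥2, 1)` | `2` | `t = 1` | `9` |
| `(0,3)` | `2` | `t₀` | `2` | | `(≥3, 2)` | `4` | `t = 1` | `10` |
| `(0, ≥4)` | `2` | `t = 4` | `2` | | `(2,2)` | `4` | `∞` | `10` |
| `(≥2, 0)`, `a = 0 ∧ B = 0` | `0` | odd `t`, `v₂ f(t) = 3` | `2` (sequel) | | `a = 0, B = 1 / 2` | `2` / `4` | `t = 1` | `9` / `10` |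

This file proves the valuation bookkeeping (§1), `Δ` as a function of `(A, B)` (§2), and every row except the two marked
«sequel» (§3); each row is an unconditional `∃ t` (or `t = ∞`) statement, so with `…CubicPencil` §5 C1″ already forces
`μ₂ = 0` for `ℚ(α)` on all these classes. The degenerate row `(0,1), Δ ≥ 7` (`t = t₀ + 2^m`, exact expansions
`Q(t₀ + δ) = −D/(4a) + 3aδ²`, `f(t₀ + δ) = D(2aδ − b)/(8a³) + δ²(3t₀ + δ)`), the isolated-root row and the assembly over all
`(a, b)` are the sequel `…CubicPencilWindowAll`.

References: [SilvermanAEC2009] VII.1.1 (valuations), III.§1; [Iwasawa1973MuInvariants] §3; [Greenberg2011ProjectiveModules] Prop. 4.1.6.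
-/

set_option autoImplicit false
-- sibling precedent (`…FineSelmerConjAAtTwoAdditivePotGoodCubicPencil.lean`): the directory name repeats the summit name
set_option linter.dupNamespace false

noncomputable section

open scoped Classical

namespace Summit.BirchSwinnertonDyer.BirchSwinnertonDyer.Theorems.AddKatoTwo

/-! ## §1 `2`-adic valuation bookkeeping over `ℚ` -/

section Val

/-- `q + r ≠ 0` when `v₂ q < v₂ r`. -/
theorem add_ne_zero_of_padicValRat_lt {q r : ℚ} (h : padicValRat 2 q < padicValRat 2 r) : q + r ≠ 0 := by
  intro h0
  have : r = -q := by linear_combination h0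
  rw [this, padicValRat.neg] at h
  exact lt_irrefl _ h

/-- **Strict ultrametric rule**: `v₂(q + r) = v₂ q` when `v₂ q < v₂ r` (`q ≠ 0`; `r = 0` allowed). -/
theorem padicValRat_add_eq_of_lt {q r : ℚ} (hq : q ≠ 0) (h : padicValRat 2 q < padicValRat 2 r) :
    padicValRat 2 (q + r) = padicValRat 2 q := by
  by_cases hr : r = 0
  · rw [hr, add_zero]
  · exact padicValRat.add_eq_of_lt (add_ne_zero_of_padicValRat_lt h) hq hr h

/-- The same with the summands swapped: `v₂(r + q) = v₂ q` when `v₂ q < v₂ r`. -/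
theorem padicValRat_add_eq_of_lt' {q r : ℚ} (hq : q ≠ 0) (h : padicValRat 2 q < padicValRat 2 r) :
    padicValRat 2 (r + q) = padicValRat 2 q := by
  rw [add_comm]; exact padicValRat_add_eq_of_lt hq h

/-- `r + q ≠ 0` when `v₂ q < v₂ r`. -/
theorem add_ne_zero_of_padicValRat_lt' {q r : ℚ} (h : padicValRat 2 q < padicValRat 2 r) : r + q ≠ 0 := by
  rw [add_comm]; exact add_ne_zero_of_padicValRat_lt h

/-- `v₂(2^k · m) = k` for an odd natural number `m`. -/
theorem padicValRat_two_pow_mul_odd' (k : ℕ) {m : ℕ} (hm : ¬ 2 ∣ m) : padicValRat 2 ((2 : ℚ) ^ k * m) = k := by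
  have hm0 : (m : ℚ) ≠ 0 := by
    intro h; apply hm; have : m = 0 := by exact_mod_cast h
    simp [this]
  have h2k : (2 : ℚ) ^ k ≠ 0 := pow_ne_zero _ two_ne_zero
  have hself : padicValRat 2 (2 : ℚ) = 1 := by exact_mod_cast padicValRat.self (p := 2) (by norm_num)
  rw [padicValRat.mul h2k hm0, padicValRat.pow, hself]
  have : padicValRat 2 (m : ℚ) = 0 := by
    rw [padicValRat.of_nat]; exact_mod_cast padicValNat.eq_zero_of_not_dvd hm
  rw [this]; ring

/-- `v₂ 3 = 0`. -/ theorem padicValRat_two_3 : padicValRat 2 (3 : ℚ) = 0 := by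
  simpa using padicValRat_two_pow_mul_odd' 0 (m := 3) (by norm_num)
/-- `v₂ 9 = 0`. -/ theorem padicValRat_two_9 : padicValRat 2 (9 : ℚ) = 0 := by
  simpa using padicValRat_two_pow_mul_odd' 0 (m := 9) (by norm_num)
/-- `v₂ 27 = 0`. -/ theorem padicValRat_two_27 : padicValRat 2 (27 : ℚ) = 0 := by
  simpa using padicValRat_two_pow_mul_odd' 0 (m := 27) (by norm_num)
/-- `v₂ 2 = 1`. -/ theorem padicValRat_two_2 : padicValRat 2 (2 : ℚ) = 1 := by
  simpa using padicValRat_two_pow_mul_odd' 1 (m := 1) (by norm_num)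
/-- `v₂ 4 = 2`. -/ theorem padicValRat_two_4 : padicValRat 2 (4 : ℚ) = 2 := by
  have := padicValRat_two_pow_mul_odd' 2 (m := 1) (by norm_num); norm_num at this; exact this
/-- `v₂ 8 = 3`. -/ theorem padicValRat_two_8 : padicValRat 2 (8 : ℚ) = 3 := by
  have := padicValRat_two_pow_mul_odd' 3 (m := 1) (by norm_num); norm_num at this; exact this
/-- `v₂ 12 = 2`. -/ theorem padicValRat_two_12 : padicValRat 2 (12 : ℚ) = 2 := by
  have := padicValRat_two_pow_mul_odd' 2 (m := 3) (by norm_num); norm_num at this; exact this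
/-- `v₂ 18 = 1`. -/ theorem padicValRat_two_18 : padicValRat 2 (18 : ℚ) = 1 := by
  have := padicValRat_two_pow_mul_odd' 1 (m := 9) (by norm_num); norm_num at this; exact this
/-- `v₂ 36 = 2`. -/ theorem padicValRat_two_36 : padicValRat 2 (36 : ℚ) = 2 := by
  have := padicValRat_two_pow_mul_odd' 2 (m := 9) (by norm_num); norm_num at this; exact this
/-- `v₂ 48 = 4`. -/ theorem padicValRat_two_48 : padicValRat 2 (48 : ℚ) = 4 := by
  have := padicValRat_two_pow_mul_odd' 4 (m := 3) (by norm_num); norm_num at this; exact this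
/-- `v₂ 64 = 6`. -/ theorem padicValRat_two_64 : padicValRat 2 (64 : ℚ) = 6 := by
  have := padicValRat_two_pow_mul_odd' 6 (m := 1) (by norm_num); norm_num at this; exact this
/-- `v₂ 256 = 8`. -/ theorem padicValRat_two_256 : padicValRat 2 (256 : ℚ) = 8 := by
  have := padicValRat_two_pow_mul_odd' 8 (m := 1) (by norm_num); norm_num at this; exact this
/-- `v₂ 6912 = 8`. -/ theorem padicValRat_two_6912 : padicValRat 2 (6912 : ℚ) = 8 := by
  have := padicValRat_two_pow_mul_odd' 8 (m := 27) (by norm_num); norm_num at this; exact this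

variable {a b : ℚ}

/-- `v₂(c · a^n) = v₂ c + n · v₂ a` (bookkeeping). -/
theorem padicValRat_const_mul_pow (c : ℚ) (hc : c ≠ 0) (ha : a ≠ 0) (n : ℕ) :
    padicValRat 2 (c * a ^ n) = padicValRat 2 c + n * padicValRat 2 a := by
  rw [padicValRat.mul hc (pow_ne_zero n ha), padicValRat.pow]

/-- **The pencil value in valuations**: `v₂(256 Q³/(D f²)) = 8 + 3 v₂ Q − v₂ D − 2 v₂ f` (`Q, D, f ≠ 0`). -/
theorem padicValRat_pencilValue {Q D f : ℚ} (hQ : Q ≠ 0) (hD : D ≠ 0) (hf : f ≠ 0) :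
    padicValRat 2 (256 * Q ^ 3 / (D * f ^ 2)) = 8 + 3 * padicValRat 2 Q - padicValRat 2 D - 2 * padicValRat 2 f := by
  rw [padicValRat.div (mul_ne_zero (by norm_num) (pow_ne_zero 3 hQ)) (mul_ne_zero hD (pow_ne_zero 2 hf)),
    padicValRat.mul (by norm_num) (pow_ne_zero 3 hQ), padicValRat.mul hD (pow_ne_zero 2 hf), padicValRat.pow, padicValRat.pow,
    padicValRat_two_256]
  push_cast; ring

/-- **The value at `t = ∞`** (the generator `α` itself): `v₂(6912 a³/D) = 8 + 3 v₂ a − v₂ D`. -/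
theorem padicValRat_infValue (ha : a ≠ 0) {D : ℚ} (hD : D ≠ 0) :
    padicValRat 2 (6912 * a ^ 3 / D) = 8 + 3 * padicValRat 2 a - padicValRat 2 D := by
  rw [padicValRat.div (mul_ne_zero (by norm_num) (pow_ne_zero 3 ha)) hD, padicValRat.mul (by norm_num) (pow_ne_zero 3 ha),
    padicValRat.pow, padicValRat_two_6912]
  push_cast; ring

end Val

/-! ## §2 `Δ = v₂(4a³ + 27b²)` from `(A, B)` when `2 + 3A ≠ 2B` -/

section Delta

variable {a b : ℚ}

/-- `v₂(4a³) = 2 + 3 v₂ a`. -/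
theorem padicValRat_four_mul_cube (ha : a ≠ 0) : padicValRat 2 (4 * a ^ 3) = 2 + 3 * padicValRat 2 a := by
  rw [padicValRat_const_mul_pow 4 (by norm_num) ha, padicValRat_two_4]; push_cast; ring

/-- `v₂(27b²) = 2 v₂ b`. -/
theorem padicValRat_twentyseven_mul_sq (hb : b ≠ 0) : padicValRat 2 (27 * b ^ 2) = 2 * padicValRat 2 b := by
  rw [padicValRat_const_mul_pow 27 (by norm_num) hb, padicValRat_two_27]; push_cast; ring

/-- **`Δ = 2B` when `2B < 2 + 3A`** (the `27b²` term dominates). -/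
theorem padicValRat_D_eq_of_lt_left (ha : a ≠ 0) (hb : b ≠ 0) (h : 2 * padicValRat 2 b < 2 + 3 * padicValRat 2 a) :
    padicValRat 2 (4 * a ^ 3 + 27 * b ^ 2) = 2 * padicValRat 2 b ∧ 4 * a ^ 3 + 27 * b ^ 2 ≠ 0 := by
  have hlt : padicValRat 2 (27 * b ^ 2) < padicValRat 2 (4 * a ^ 3) := by
    rw [padicValRat_twentyseven_mul_sq hb, padicValRat_four_mul_cube ha]; exact h
  have h27 : 27 * b ^ 2 ≠ 0 := mul_ne_zero (by norm_num) (pow_ne_zero 2 hb)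
  exact ⟨by rw [padicValRat_add_eq_of_lt' h27 hlt, padicValRat_twentyseven_mul_sq hb], add_ne_zero_of_padicValRat_lt' hlt⟩

/-- `Δ = 2B` when `a = 0`. -/
theorem padicValRat_D_eq_of_a_eq_zero (ha : a = 0) (hb : b ≠ 0) :
    padicValRat 2 (4 * a ^ 3 + 27 * b ^ 2) = 2 * padicValRat 2 b ∧ 4 * a ^ 3 + 27 * b ^ 2 ≠ 0 := by
  subst ha
  refine ⟨by simp [padicValRat_twentyseven_mul_sq hb], ?_⟩
  simpa using mul_ne_zero (by norm_num : (27 : ℚ) ≠ 0) (pow_ne_zero 2 hb)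

/-- **`Δ = 2 + 3A` when `2 + 3A < 2B`** (the `4a³` term dominates). -/
theorem padicValRat_D_eq_of_lt_right (ha : a ≠ 0) (hb : b ≠ 0) (h : 2 + 3 * padicValRat 2 a < 2 * padicValRat 2 b) :
    padicValRat 2 (4 * a ^ 3 + 27 * b ^ 2) = 2 + 3 * padicValRat 2 a ∧ 4 * a ^ 3 + 27 * b ^ 2 ≠ 0 := by
  have hlt : padicValRat 2 (4 * a ^ 3) < padicValRat 2 (27 * b ^ 2) := by
    rw [padicValRat_twentyseven_mul_sq hb, padicValRat_four_mul_cube ha]; exact h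
  have h4 : 4 * a ^ 3 ≠ 0 := mul_ne_zero (by norm_num) (pow_ne_zero 3 ha)
  exact ⟨by rw [padicValRat_add_eq_of_lt h4 hlt, padicValRat_four_mul_cube ha], add_ne_zero_of_padicValRat_lt hlt⟩

end Delta

/-! ## §3 The rows of the table -/

section Rows

variable {a b : ℚ}

/-- **Rows with member `t = ∞`**: `(A, B) = (0,0), (1,0), (1,1), (1,2), (2,2)` give `v₂(6912a³/D) = 8, 11, 9, 7, 10`. -/
theorem infValue_mem_window_of_rows (ha : a ≠ 0) (hb : b ≠ 0)
    (h : (padicValRat 2 a = 0 ∧ padicValRat 2 b = 0) ∨ (padicValRat 2 a = 1 ∧ padicValRat 2 b = 0) ∨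
      (padicValRat 2 a = 1 ∧ padicValRat 2 b = 1) ∨ (padicValRat 2 a = 1 ∧ padicValRat 2 b = 2) ∨
      (padicValRat 2 a = 2 ∧ padicValRat 2 b = 2)) :
    4 * a ^ 3 + 27 * b ^ 2 ≠ 0 ∧
      padicValRat 2 (6912 * a ^ 3 / (4 * a ^ 3 + 27 * b ^ 2)) ∈ ({1, 2, 5, 7, 8, 9, 10, 11} : Finset ℤ) := by
  have hlt : 2 * padicValRat 2 b < 2 + 3 * padicValRat 2 a := by rcases h with h | h | h | h | h <;> omega
  obtain ⟨hΔ, hD⟩ := padicValRat_D_eq_of_lt_left ha hb hlt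
  refine ⟨hD, ?_⟩
  rw [padicValRat_infValue ha hD, hΔ]
  rcases h with ⟨hA, hB⟩ | ⟨hA, hB⟩ | ⟨hA, hB⟩ | ⟨hA, hB⟩ | ⟨hA, hB⟩ <;> rw [hA, hB] <;> decide

/-- **Rows with member `t = 0`** (`Q(0) = −a²`, `f(0) = b`, value `8 + 6A − Δ − 2B`): `(A, B) = (0, 2)` gives `2`. -/
theorem zeroValue_mem_window_of_row_02 (ha : a ≠ 0) (hb : b ≠ 0) (hA : padicValRat 2 a = 0) (hB : padicValRat 2 b = 2) :
    3 * a * 0 ^ 2 + 9 * b * 0 - a ^ 2 ≠ 0 ∧ (0 : ℚ) ^ 3 + a * 0 + b ≠ 0 ∧ 4 * a ^ 3 + 27 * b ^ 2 ≠ 0 ∧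
      padicValRat 2 (256 * (3 * a * 0 ^ 2 + 9 * b * 0 - a ^ 2) ^ 3 / ((4 * a ^ 3 + 27 * b ^ 2) * ((0 : ℚ) ^ 3 + a * 0 + b) ^ 2)) ∈
        ({1, 2, 5, 7, 8, 9, 10, 11} : Finset ℤ) := by
  obtain ⟨hΔ, hD⟩ := padicValRat_D_eq_of_lt_right ha hb (by rw [hA, hB]; norm_num)
  have hQ : 3 * a * 0 ^ 2 + 9 * b * 0 - a ^ 2 = -a ^ 2 := by ring
  have hf : (0 : ℚ) ^ 3 + a * 0 + b = b := by ring
  rw [hQ, hf]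
  refine ⟨neg_ne_zero.mpr (pow_ne_zero 2 ha), hb, hD, ?_⟩
  rw [padicValRat_pencilValue (neg_ne_zero.mpr (pow_ne_zero 2 ha)) hD hb, padicValRat.neg, padicValRat.pow, hΔ, hA, hB]
  decide

/-- **Row `(A, B) = (0, 1)` with `Δ ∈ {4, 5}`, member `t = 0`**: value `6 − Δ ∈ {2, 1}`. -/
theorem zeroValue_mem_window_of_row_01 (ha : a ≠ 0) (hb : b ≠ 0) (hA : padicValRat 2 a = 0) (hB : padicValRat 2 b = 1)
    (hD : 4 * a ^ 3 + 27 * b ^ 2 ≠ 0)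
    (hΔ : padicValRat 2 (4 * a ^ 3 + 27 * b ^ 2) = 4 ∨ padicValRat 2 (4 * a ^ 3 + 27 * b ^ 2) = 5) :
    3 * a * 0 ^ 2 + 9 * b * 0 - a ^ 2 ≠ 0 ∧ (0 : ℚ) ^ 3 + a * 0 + b ≠ 0 ∧
      padicValRat 2 (256 * (3 * a * 0 ^ 2 + 9 * b * 0 - a ^ 2) ^ 3 / ((4 * a ^ 3 + 27 * b ^ 2) * ((0 : ℚ) ^ 3 + a * 0 + b) ^ 2)) ∈
        ({1, 2, 5, 7, 8, 9, 10, 11} : Finset ℤ) := by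
  have hQ : 3 * a * 0 ^ 2 + 9 * b * 0 - a ^ 2 = -a ^ 2 := by ring
  have hf : (0 : ℚ) ^ 3 + a * 0 + b = b := by ring
  rw [hQ, hf]
  refine ⟨neg_ne_zero.mpr (pow_ne_zero 2 ha), hb, ?_⟩
  rw [padicValRat_pencilValue (neg_ne_zero.mpr (pow_ne_zero 2 ha)) hD hb, padicValRat.neg, padicValRat.pow, hA, hB]
  rcases hΔ with hΔ | hΔ <;> rw [hΔ] <;> decide

/-- **Row `(A, B) = (0, 1)` with `Δ ∈ {3, 6}`, member `t = ∞`**: value `8 − Δ ∈ {5, 2}`. -/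
theorem infValue_mem_window_of_row_01 (ha : a ≠ 0) (hA : padicValRat 2 a = 0) (hD : 4 * a ^ 3 + 27 * b ^ 2 ≠ 0)
    (hΔ : padicValRat 2 (4 * a ^ 3 + 27 * b ^ 2) = 3 ∨ padicValRat 2 (4 * a ^ 3 + 27 * b ^ 2) = 6) :
    padicValRat 2 (6912 * a ^ 3 / (4 * a ^ 3 + 27 * b ^ 2)) ∈ ({1, 2, 5, 7, 8, 9, 10, 11} : Finset ℤ) := by
  rw [padicValRat_infValue ha hD, hA]
  rcases hΔ with hΔ | hΔ <;> rw [hΔ] <;> decide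

/-- **Row `(A, B) = (0, 3)`, member `t₀ = −3b/(2a)`** (value `−256a³/b²`): `v₂ = 8 − 6 = 2`. -/
theorem t0Value_mem_window_of_row_03 (ha : a ≠ 0) (hb : b ≠ 0) (hA : padicValRat 2 a = 0) (hB : padicValRat 2 b = 3) :
    padicValRat 2 (-(256 * a ^ 3) / b ^ 2) ∈ ({1, 2, 5, 7, 8, 9, 10, 11} : Finset ℤ) := by
  rw [neg_div, padicValRat.neg, padicValRat.div (mul_ne_zero (by norm_num) (pow_ne_zero 3 ha)) (pow_ne_zero 2 hb),
    padicValRat.mul (by norm_num) (pow_ne_zero 3 ha), padicValRat.pow, padicValRat.pow, padicValRat_two_256, hA, hB]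
  decide

/-- **Row `(A, B) = (0, ≥ 4)`, member `t = 4`**: `v₂ Q(4) = 0`, `v₂ f(4) = 2`, `Δ = 2`, value `2`. -/
theorem fourValue_mem_window_of_row_0ge4 (ha : a ≠ 0) (hb : b ≠ 0) (hA : padicValRat 2 a = 0) (hB : 4 ≤ padicValRat 2 b) :
    3 * a * 4 ^ 2 + 9 * b * 4 - a ^ 2 ≠ 0 ∧ (4 : ℚ) ^ 3 + a * 4 + b ≠ 0 ∧ 4 * a ^ 3 + 27 * b ^ 2 ≠ 0 ∧
      padicValRat 2 (256 * (3 * a * 4 ^ 2 + 9 * b * 4 - a ^ 2) ^ 3 / ((4 * a ^ 3 + 27 * b ^ 2) * ((4 : ℚ) ^ 3 + a * 4 + b) ^ 2)) ∈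
        ({1, 2, 5, 7, 8, 9, 10, 11} : Finset ℤ) := by
  obtain ⟨hΔ, hD⟩ := padicValRat_D_eq_of_lt_right ha hb (by rw [hA]; omega)
  -- `Q(4) = -a² + (48a + 36b)`: the unit `-a²` dominates
  have ha2 : -a ^ 2 ≠ 0 := neg_ne_zero.mpr (pow_ne_zero 2 ha)
  have hva2 : padicValRat 2 (-a ^ 2) = 0 := by rw [padicValRat.neg, padicValRat.pow, hA]; ring
  have h48 : padicValRat 2 (48 * a) = 4 := by rw [padicValRat.mul (by norm_num) ha, padicValRat_two_48, hA]; ring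
  have h36 : padicValRat 2 (36 * b) = 2 + padicValRat 2 b := by rw [padicValRat.mul (by norm_num) hb, padicValRat_two_36]
  have h48ne : (48 : ℚ) * a ≠ 0 := mul_ne_zero (by norm_num) ha
  have hrest : padicValRat 2 (48 * a + 36 * b) = 4 := by
    rw [padicValRat_add_eq_of_lt h48ne (by rw [h48]; have := h36; have := hB; omega), h48]
  have hrestne : 48 * a + 36 * b ≠ 0 := add_ne_zero_of_padicValRat_lt (by rw [h48]; have := h36; have := hB; omega)
  have hQeq : 3 * a * 4 ^ 2 + 9 * b * 4 - a ^ 2 = -a ^ 2 + (48 * a + 36 * b) := by ring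
  have hvQ : padicValRat 2 (3 * a * 4 ^ 2 + 9 * b * 4 - a ^ 2) = 0 := by
    rw [hQeq, padicValRat_add_eq_of_lt ha2 (by rw [hva2, hrest]; norm_num), hva2]
  have hQne : 3 * a * 4 ^ 2 + 9 * b * 4 - a ^ 2 ≠ 0 := by
    rw [hQeq]; exact add_ne_zero_of_padicValRat_lt (by rw [hva2, hrest]; norm_num)
  -- `f(4) = 4a + (64 + b)`: `4a` (valuation 2) dominates
  have h4a : padicValRat 2 (4 * a) = 2 := by rw [padicValRat.mul (by norm_num) ha, padicValRat_two_4, hA]; ring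
  have h4ane : (4 : ℚ) * a ≠ 0 := mul_ne_zero (by norm_num) ha
  have hfeq : (4 : ℚ) ^ 3 + a * 4 + b = 4 * a + (64 + b) := by ring
  have hvf : padicValRat 2 ((4 : ℚ) ^ 3 + a * 4 + b) = 2 ∧ (4 : ℚ) ^ 3 + a * 4 + b ≠ 0 := by
    rw [hfeq]
    by_cases heq : (64 : ℚ) + b = 0
    · rw [heq, add_zero, h4a]; exact ⟨rfl, h4ane⟩
    · have h64b : 2 < padicValRat 2 (64 + b) := by
        have := padicValRat.min_le_padicValRat_add (p := 2) heq
        rw [padicValRat_two_64] at this; omega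
      exact ⟨by rw [padicValRat_add_eq_of_lt h4ane (by rw [h4a]; exact h64b), h4a],
        add_ne_zero_of_padicValRat_lt (by rw [h4a]; exact h64b)⟩
  obtain ⟨hvf, hfne⟩ := hvf
  refine ⟨hQne, hfne, hD, ?_⟩
  rw [padicValRat_pencilValue hQne hD hfne, hvQ, hvf, hΔ, hA]
  decide

/-- **Row `(A, B) = (1, ≥ 3)`, member `t = 2`**: `v₂ Q(2) = 2`, `v₂ f(2) = 2`, `Δ = 5`, value `5`. -/
theorem twoValue_mem_window_of_row_1ge3 (ha : a ≠ 0) (hb : b ≠ 0) (hA : padicValRat 2 a = 1) (hB : 3 ≤ padicValRat 2 b) :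
    3 * a * 2 ^ 2 + 9 * b * 2 - a ^ 2 ≠ 0 ∧ (2 : ℚ) ^ 3 + a * 2 + b ≠ 0 ∧ 4 * a ^ 3 + 27 * b ^ 2 ≠ 0 ∧
      padicValRat 2 (256 * (3 * a * 2 ^ 2 + 9 * b * 2 - a ^ 2) ^ 3 / ((4 * a ^ 3 + 27 * b ^ 2) * ((2 : ℚ) ^ 3 + a * 2 + b) ^ 2)) ∈
        ({1, 2, 5, 7, 8, 9, 10, 11} : Finset ℤ) := by
  obtain ⟨hΔ, hD⟩ := padicValRat_D_eq_of_lt_right ha hb (by rw [hA]; omega)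
  -- `Q(2) = -a² + (12a + 18b)`: `-a²` (valuation 2) dominates (`12a`: 3, `18b`: ≥ 4)
  have ha2 : -a ^ 2 ≠ 0 := neg_ne_zero.mpr (pow_ne_zero 2 ha)
  have hva2 : padicValRat 2 (-a ^ 2) = 2 := by rw [padicValRat.neg, padicValRat.pow, hA]; ring
  have h12 : padicValRat 2 (12 * a) = 3 := by rw [padicValRat.mul (by norm_num) ha, padicValRat_two_12, hA]; ring
  have h18 : padicValRat 2 (18 * b) = 1 + padicValRat 2 b := by rw [padicValRat.mul (by norm_num) hb, padicValRat_two_18]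
  have h12ne : (12 : ℚ) * a ≠ 0 := mul_ne_zero (by norm_num) ha
  have hrest : padicValRat 2 (12 * a + 18 * b) = 3 := by
    rw [padicValRat_add_eq_of_lt h12ne (by rw [h12]; have := h18; have := hB; omega), h12]
  have hQeq : 3 * a * 2 ^ 2 + 9 * b * 2 - a ^ 2 = -a ^ 2 + (12 * a + 18 * b) := by ring
  have hvQ : padicValRat 2 (3 * a * 2 ^ 2 + 9 * b * 2 - a ^ 2) = 2 := by
    rw [hQeq, padicValRat_add_eq_of_lt ha2 (by rw [hva2, hrest]; norm_num), hva2]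
  have hQne : 3 * a * 2 ^ 2 + 9 * b * 2 - a ^ 2 ≠ 0 := by
    rw [hQeq]; exact add_ne_zero_of_padicValRat_lt (by rw [hva2, hrest]; norm_num)
  -- `f(2) = 2a + (8 + b)`: `2a` (valuation 2) dominates (`8`: 3, `b`: ≥ 3)
  have h2a : padicValRat 2 (2 * a) = 2 := by rw [padicValRat.mul (by norm_num) ha, padicValRat_two_2, hA]; ring
  have h2ane : (2 : ℚ) * a ≠ 0 := mul_ne_zero (by norm_num) ha
  have hfeq : (2 : ℚ) ^ 3 + a * 2 + b = 2 * a + (8 + b) := by ring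
  have hvf : padicValRat 2 ((2 : ℚ) ^ 3 + a * 2 + b) = 2 ∧ (2 : ℚ) ^ 3 + a * 2 + b ≠ 0 := by
    rw [hfeq]
    by_cases heq : (8 : ℚ) + b = 0
    · rw [heq, add_zero, h2a]; exact ⟨rfl, h2ane⟩
    · have h8b : 2 < padicValRat 2 (8 + b) := by
        have := padicValRat.min_le_padicValRat_add (p := 2) heq
        rw [padicValRat_two_8] at this; omega
      exact ⟨by rw [padicValRat_add_eq_of_lt h2ane (by rw [h2a]; exact h8b), h2a],
        add_ne_zero_of_padicValRat_lt (by rw [h2a]; exact h8b)⟩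
  obtain ⟨hvf, hfne⟩ := hvf
  refine ⟨hQne, hfne, hD, ?_⟩
  rw [padicValRat_pencilValue hQne hD hfne, hvQ, hvf, hΔ, hA]
  decide

/-- **Rows with member `t = 1`**: `(A, B) = (≥2, 1)` (value `9`), `(≥3, 2)` (value `10`), and the pure cubics `a = 0`,
`B ∈ {1, 2}` (values `9`, `10`): `v₂ Q(1) = B` (the term `9b`), `v₂ f(1) = 0` (the term `1`), `Δ = 2B`. -/
theorem oneValue_mem_window_of_rows (hb : b ≠ 0)
    (h : (a ≠ 0 ∧ 2 ≤ padicValRat 2 a ∧ padicValRat 2 b = 1) ∨ (a ≠ 0 ∧ 3 ≤ padicValRat 2 a ∧ padicValRat 2 b = 2) ∨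
      (a = 0 ∧ (padicValRat 2 b = 1 ∨ padicValRat 2 b = 2))) :
    3 * a * 1 ^ 2 + 9 * b * 1 - a ^ 2 ≠ 0 ∧ (1 : ℚ) ^ 3 + a * 1 + b ≠ 0 ∧ 4 * a ^ 3 + 27 * b ^ 2 ≠ 0 ∧
      padicValRat 2 (256 * (3 * a * 1 ^ 2 + 9 * b * 1 - a ^ 2) ^ 3 / ((4 * a ^ 3 + 27 * b ^ 2) * ((1 : ℚ) ^ 3 + a * 1 + b) ^ 2)) ∈
        ({1, 2, 5, 7, 8, 9, 10, 11} : Finset ℤ) := by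
  have hB12 : padicValRat 2 b = 1 ∨ padicValRat 2 b = 2 := by
    rcases h with ⟨-, -, h1⟩ | ⟨-, -, h2⟩ | ⟨-, h12⟩
    · exact Or.inl h1
    · exact Or.inr h2
    · exact h12
  -- `Δ = 2B`
  have hΔD : padicValRat 2 (4 * a ^ 3 + 27 * b ^ 2) = 2 * padicValRat 2 b ∧ 4 * a ^ 3 + 27 * b ^ 2 ≠ 0 := by
    rcases h with ⟨ha, hA, hB⟩ | ⟨ha, hA, hB⟩ | ⟨ha, -⟩
    · exact padicValRat_D_eq_of_lt_left ha hb (by rw [hB]; omega)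
    · exact padicValRat_D_eq_of_lt_left ha hb (by rw [hB]; omega)
    · exact padicValRat_D_eq_of_a_eq_zero ha hb
  obtain ⟨hΔ, hD⟩ := hΔD
  have h9 : padicValRat 2 (9 * b) = padicValRat 2 b := by rw [padicValRat.mul (by norm_num) hb, padicValRat_two_9]; ring
  have h9ne : (9 : ℚ) * b ≠ 0 := mul_ne_zero (by norm_num) hb
  -- `Q(1) = 9b + (3a − a²)`, `f(1) = 1 + (a + b)`
  have hQeq : 3 * a * 1 ^ 2 + 9 * b * 1 - a ^ 2 = 9 * b + (3 * a - a ^ 2) := by ring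
  have hfeq : (1 : ℚ) ^ 3 + a * 1 + b = 1 + (a + b) := by ring
  have hrestQ : padicValRat 2 (9 * b) < padicValRat 2 (3 * a - a ^ 2) ∨ 3 * a - a ^ 2 = 0 := by
    rcases h with ⟨ha, hA, hB⟩ | ⟨ha, hA, hB⟩ | ⟨ha, -⟩
    · left
      have h3a : padicValRat 2 (3 * a) = padicValRat 2 a := by rw [padicValRat.mul (by norm_num) ha, padicValRat_two_3]; ring
      have haa : padicValRat 2 (-a ^ 2) = 2 * padicValRat 2 a := by rw [padicValRat.neg, padicValRat.pow]; ring
      have h3ane : (3 : ℚ) * a ≠ 0 := mul_ne_zero (by norm_num) ha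
      rw [sub_eq_add_neg, padicValRat_add_eq_of_lt h3ane (by rw [h3a, haa]; omega), h3a, h9, hB]; omega
    · left
      have h3a : padicValRat 2 (3 * a) = padicValRat 2 a := by rw [padicValRat.mul (by norm_num) ha, padicValRat_two_3]; ring
      have haa : padicValRat 2 (-a ^ 2) = 2 * padicValRat 2 a := by rw [padicValRat.neg, padicValRat.pow]; ring
      have h3ane : (3 : ℚ) * a ≠ 0 := mul_ne_zero (by norm_num) ha
      rw [sub_eq_add_neg, padicValRat_add_eq_of_lt h3ane (by rw [h3a, haa]; omega), h3a, h9, hB]; omega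
    · right; rw [ha]; ring
  have hvQ : padicValRat 2 (3 * a * 1 ^ 2 + 9 * b * 1 - a ^ 2) = padicValRat 2 b := by
    rw [hQeq]
    rcases hrestQ with hlt | h0
    · rw [padicValRat_add_eq_of_lt h9ne hlt, h9]
    · rw [h0, add_zero, h9]
  have hQne : 3 * a * 1 ^ 2 + 9 * b * 1 - a ^ 2 ≠ 0 := by
    rw [hQeq]
    rcases hrestQ with hlt | h0
    · exact add_ne_zero_of_padicValRat_lt hlt
    · rw [h0, add_zero]; exact h9ne
  have hrestf : padicValRat 2 (1 : ℚ) < padicValRat 2 (a + b) := by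
    rw [padicValRat.one]
    rcases h with ⟨ha, hA, hB⟩ | ⟨ha, hA, hB⟩ | ⟨ha, hB⟩
    · rw [add_comm, padicValRat_add_eq_of_lt hb (by rw [hB]; omega), hB]; norm_num
    · rw [add_comm, padicValRat_add_eq_of_lt hb (by rw [hB]; omega), hB]; norm_num
    · rw [ha, zero_add]; rcases hB with hB | hB <;> rw [hB] <;> norm_num
  have hvf : padicValRat 2 ((1 : ℚ) ^ 3 + a * 1 + b) = 0 := by
    rw [hfeq, padicValRat_add_eq_of_lt one_ne_zero hrestf, padicValRat.one]
  have hfne : (1 : ℚ) ^ 3 + a * 1 + b ≠ 0 := by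
    rw [hfeq]; exact add_ne_zero_of_padicValRat_lt hrestf
  refine ⟨hQne, hfne, hD, ?_⟩
  rw [padicValRat_pencilValue hQne hD hfne, hvQ, hvf, hΔ]
  rcases hB12 with hB | hB <;> rw [hB] <;> decide

end Rows

end Summit.BirchSwinnertonDyer.BirchSwinnertonDyer.Theorems.AddKatoTwo

end
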